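import Summits.RiemannHypothesis.RiemannHypothesis.Theorems.WeilFormatCWindowMargin
import Summits.RiemannHypothesis.RiemannHypothesis.Theorems.WeilFormatCSectorSplit
import Summits.RiemannHypothesis.RiemannHypothesis.Theorems.WeilFormatCEntrySesq
import Summits.RiemannHypothesis.RiemannHypothesis.Theorems.WeilFormatCEntryGram
import HarnessLib

/-!
# Format C (Fourier–Galerkin certificates of Weil positivity): the MARGIN rung in sector-kernel form —
  `M⁺ − μ·diag(1,½,½,…) ⪰ 0` and `M⁻ − (μ/2)·1 ⪰ 0` on every truncation ⟹ `μ ≤ weilGroundEnergy a`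

Helper file (`--supports stmt-RiemannHypothesis-0098`, lead-track anchor), RH-free, no definitions, no named
facts. Seat rh-explicit-weil-3 (gen3). The non-strict rung `WeilPositivityOn a` from two families of real PSD
sector kernels is weil-2's `weilPositivityOn_of_gramCoeff_sector_psd` (`WeilFormatCEntryGram.lean`) / weil-10's
`weilPositivityOn_of_sector_kernels_nonneg` (`WeilFormatCSectorKernels.lean`). A certificate usually proves MORE —
an explicit margin `μ > 0` (the strict rungs `0 < μ ≤ ε(a) = weilGroundEnergy a`, which Yoshida's threshold theory
and the `weilGroundEnergy_…_ge` ladder consume). This file is the margin version in the SAME sector-kernel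
language (kernels copied verbatim from `sum_modes_mul_mul_eq_sectors`, `WeilFormatCSectorSplit.lean`):

* `le_weilGroundEnergy_of_kernel_margin`: if `weilWindowSesq a χ_m χ_n = ↑(G m n)` for a real kernel `G` and
  `μ Σ_{|n|≤N} x_n² ≤ Σ x_n x_m G(n,m)` for all `N`, `x`, then `μ ≤ weilGroundEnergy a`
  (`le_weilGroundEnergy_of_real_gram_margin`, `WeilFormatCWindowMargin.lean`, with the matrix identified);
* `sum_modes_sq_eq_sectors`: the `ℓ²` norm in the sector coordinates `y₀ = x₀`, `y_n = x_n + x_{−n}`,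
  `z_k = x_{k+1} − x_{−(k+1)}` of the sector split: `Σ_{|n|≤N} x_n² = Σ_{n≤N} w_n y_n² + Σ_{k<N} z_k²/2`,
  `w₀ = 1`, `w_n = ½` (`n ≥ 1`);
* **`le_weilGroundEnergy_of_sector_kernels_margin`**: `G(−n,−m) = G(n,m)` and, on every `range K`,
  `μ Σ w_n y_n² ≤ Σ y_n y_m M⁺_G(n,m)` and `μ Σ z_k²/2 ≤ Σ z_k z_l M⁻_G(k,l)` ⟹ `μ ≤ weilGroundEnergy a`;
* **`le_weilGroundEnergy_of_gramCoeff_sector_margin`**: the instance `G = Yoshida1992.gramCoeff a` (weil-2's bridge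
  `weilWindowSesq_chi` and reflection symmetry `gramCoeff_neg_neg`) — the statement a format-C certificate WITH
  MARGIN targets; `0 < μ` then gives `0 < weilGroundEnergy a`.
-/

set_option autoImplicit false
set_option linter.dupNamespace false  -- the mandated namespace repeats `RiemannHypothesis`

noncomputable section

open Complex Filter Set MeasureTheory
open scoped Real Topology ComplexConjugate

namespace Summit.RiemannHypothesis.RiemannHypothesis.Theorems.WeilFormatC

open Literature.NumberTheory.LFunctions
open Literature.NumberTheory.LFunctions.Yoshida1992 (modes chi gramCoeff)

variable {a : ℝ}

/-- **Margin rung, kernel form.** Let `a > 0` and let the real kernel `G` model the Gram matrix of the window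
form on Yoshida's basis, `weilWindowSesq a χ_m χ_n = ↑(G m n)`. If `μ Σ_{|n|≤N} x_n² ≤ Σ_{|n|,|m|≤N} x_n x_m G(n,m)`
for every `N` and every real `x` (`G − μ·1 ⪰ 0` on every truncation), then `μ ≤ weilGroundEnergy a`. -/
theorem le_weilGroundEnergy_of_kernel_margin (ha : 0 < a) (G : ℤ → ℤ → ℝ)
    (hG : ∀ m n : ℤ, weilWindowSesq a (chi a m) (chi a n) = ((G m n : ℝ) : ℂ)) {μ : ℝ}
    (h : ∀ (N : ℕ) (x : ℤ → ℝ), μ * ∑ n ∈ modes N, x n ^ 2 ≤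
      ∑ n ∈ modes N, ∑ m ∈ modes N, x n * x m * G n m) :
    μ ≤ weilGroundEnergy a := by
  refine le_weilGroundEnergy_of_real_gram_margin ha (fun m n ↦ by rw [hG m n, Complex.ofReal_im])
    fun N x ↦ ?_
  have e : ∑ m ∈ modes N, ∑ n ∈ modes N, x m * x n * (weilWindowSesq a (chi a m) (chi a n)).re =
      ∑ n ∈ modes N, ∑ m ∈ modes N, x n * x m * G n m :=
    Finset.sum_congr rfl fun m _ ↦ Finset.sum_congr rfl fun n _ ↦ by rw [hG m n, Complex.ofReal_re]
  rw [e]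
  exact h N x

/-- **The `ℓ²` norm in sector coordinates.** With `y₀ = x₀`, `y_n = x_n + x_{−n}` (`n ≥ 1`) and
`z_k = x_{k+1} − x_{−(k+1)}` (the coordinates of `sum_modes_mul_mul_eq_sectors`):
`Σ_{|n|≤N} x_n² = Σ_{n≤N} w_n y_n² + Σ_{k<N} z_k²/2`, `w₀ = 1`, `w_n = ½`. -/
theorem sum_modes_sq_eq_sectors (N : ℕ) (x : ℤ → ℝ) :
    ∑ n ∈ modes N, x n ^ 2 =
      (∑ n ∈ Finset.range (N + 1), (if n = 0 then (1 : ℝ) else 1 / 2) *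
          (if n = 0 then x 0 else x n + x (-(n : ℤ))) ^ 2) +
        ∑ k ∈ Finset.range N, (x ((k : ℤ) + 1) - x (-((k : ℤ) + 1))) ^ 2 / 2 := by
  rw [sum_modes_eq (fun n ↦ x n ^ 2) N, Finset.sum_range_succ']
  simp only [Nat.cast_succ, Nat.cast_zero, Nat.add_one_ne_zero, if_false, if_true, one_mul]
  rw [add_comm (∑ k ∈ Finset.range N, _) (x 0 ^ 2), add_assoc, ← Finset.sum_add_distrib]
  congr 1
  exact Finset.sum_congr rfl fun k _ ↦ by ring

/-- **Margin rung, sector-kernel form.** Let `a > 0`, let `G` be a real kernel with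
`weilWindowSesq a χ_m χ_n = ↑(G m n)` and `G(−n,−m) = G(n,m)`, and let `M⁺_G`, `M⁻_G` be its even / odd sector
kernels (`M⁺(0,m) = G(0,m)`, `M⁺(n,0) = G(n,0)`, `M⁺(n,m) = (G(n,m) + G(n,−m))/2`;
`M⁻(k,l) = (G(k+1,l+1) − G(k+1,−(l+1)))/2`). If on every `range K`
`μ Σ_n w_n y_n² ≤ Σ_{n,m} y_n y_m M⁺(n,m)` (`w₀ = 1`, `w_n = ½`) and `μ Σ_k z_k²/2 ≤ Σ_{k,l} z_k z_l M⁻(k,l)` —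
i.e. `M⁺ − μ·diag(1,½,½,…) ⪰ 0` and `M⁻ − (μ/2)·1 ⪰ 0`, the output of an `LDLᵀ` check per sector — then
`μ ≤ weilGroundEnergy a`. -/
theorem le_weilGroundEnergy_of_sector_kernels_margin (ha : 0 < a) (G : ℤ → ℤ → ℝ)
    (hG : ∀ m n : ℤ, weilWindowSesq a (chi a m) (chi a n) = ((G m n : ℝ) : ℂ))
    (hrefl : ∀ n m, G (-n) (-m) = G n m) {μ : ℝ}
    (hev : ∀ (K : ℕ) (y : ℕ → ℝ),
      μ * ∑ n ∈ Finset.range K, (if n = 0 then (1 : ℝ) else 1 / 2) * y n ^ 2 ≤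
        ∑ n ∈ Finset.range K, ∑ m ∈ Finset.range K,
          y n * y m * (if n = 0 then G 0 m else if m = 0 then G n 0 else (G n m + G n (-(m : ℤ))) / 2))
    (hod : ∀ (K : ℕ) (z : ℕ → ℝ),
      μ * ∑ k ∈ Finset.range K, z k ^ 2 / 2 ≤
        ∑ k ∈ Finset.range K, ∑ l ∈ Finset.range K,
          z k * z l * ((G ((k : ℤ) + 1) ((l : ℤ) + 1) - G ((k : ℤ) + 1) (-((l : ℤ) + 1))) / 2)) :
    μ ≤ weilGroundEnergy a := by
  refine le_weilGroundEnergy_of_kernel_margin ha G hG fun N x ↦ ?_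
  rw [sum_modes_mul_mul_eq_sectors G hrefl N x, sum_modes_sq_eq_sectors N x, mul_add]
  exact add_le_add (hev (N + 1) fun n ↦ if n = 0 then x 0 else x n + x (-(n : ℤ)))
    (hod N fun k ↦ x ((k : ℤ) + 1) - x (-((k : ℤ) + 1)))

/-- **Margin rung for Yoshida's matrix** (`G = gramCoeff a`, Yoshida 1992 (5.15)/(5.16); `a > 0`): if on every
`range K` the even sector kernel satisfies `μ Σ_n w_n y_n² ≤ Σ y_n y_m M⁺(n,m)` (`w₀ = 1`, `w_n = ½`) and the odd
one `μ Σ_k z_k²/2 ≤ Σ z_k z_l M⁻(k,l)`, then `μ ≤ weilGroundEnergy a` — the statement a format-C certificate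
with margin `μ` targets (for `μ = 0` this is `weilPositivityOn_of_gramCoeff_sector_psd`'s hypothesis). -/
theorem le_weilGroundEnergy_of_gramCoeff_sector_margin (ha : 0 < a) {μ : ℝ}
    (hev : ∀ (K : ℕ) (y : ℕ → ℝ),
      μ * ∑ n ∈ Finset.range K, (if n = 0 then (1 : ℝ) else 1 / 2) * y n ^ 2 ≤
        ∑ n ∈ Finset.range K, ∑ m ∈ Finset.range K,
          y n * y m * (if n = 0 then gramCoeff a 0 m else if m = 0 then gramCoeff a n 0
            else (gramCoeff a n m + gramCoeff a n (-(m : ℤ))) / 2))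
    (hod : ∀ (K : ℕ) (z : ℕ → ℝ),
      μ * ∑ k ∈ Finset.range K, z k ^ 2 / 2 ≤
        ∑ k ∈ Finset.range K, ∑ l ∈ Finset.range K,
          z k * z l * ((gramCoeff a ((k : ℤ) + 1) ((l : ℤ) + 1) -
            gramCoeff a ((k : ℤ) + 1) (-((l : ℤ) + 1))) / 2)) :
    μ ≤ weilGroundEnergy a :=
  le_weilGroundEnergy_of_sector_kernels_margin ha (gramCoeff a) (weilWindowSesq_chi ha)
    (gramCoeff_neg_neg a) hev hod

/-- **Strict rung.** Under the hypotheses of `le_weilGroundEnergy_of_gramCoeff_sector_margin` with `0 < μ`: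
`0 < weilGroundEnergy a`. -/
theorem weilGroundEnergy_pos_of_gramCoeff_sector_margin (ha : 0 < a) {μ : ℝ} (hμ : 0 < μ)
    (hev : ∀ (K : ℕ) (y : ℕ → ℝ),
      μ * ∑ n ∈ Finset.range K, (if n = 0 then (1 : ℝ) else 1 / 2) * y n ^ 2 ≤
        ∑ n ∈ Finset.range K, ∑ m ∈ Finset.range K,
          y n * y m * (if n = 0 then gramCoeff a 0 m else if m = 0 then gramCoeff a n 0
            else (gramCoeff a n m + gramCoeff a n (-(m : ℤ))) / 2))
    (hod : ∀ (K : ℕ) (z : ℕ → ℝ),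
      μ * ∑ k ∈ Finset.range K, z k ^ 2 / 2 ≤
        ∑ k ∈ Finset.range K, ∑ l ∈ Finset.range K,
          z k * z l * ((gramCoeff a ((k : ℤ) + 1) ((l : ℤ) + 1) -
            gramCoeff a ((k : ℤ) + 1) (-((l : ℤ) + 1))) / 2)) :
    0 < weilGroundEnergy a :=
  hμ.trans_le (le_weilGroundEnergy_of_gramCoeff_sector_margin ha hev hod)

/-! ## The same with SHIFTED kernels — the literal output shape of `sum_range_mul_mul_nonneg_of_certificate` -/

/-- Subtracting a diagonal `d` from a kernel subtracts the weighted sum of squares `Σ d_n y_n²` from its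
quadratic form on `range K`. -/
theorem sum_range_mul_mul_sub_diag (K : ℕ) (y : ℕ → ℝ) (M : ℕ → ℕ → ℝ) (d : ℕ → ℝ) :
    ∑ n ∈ Finset.range K, ∑ m ∈ Finset.range K, y n * y m * (M n m - if n = m then d n else 0) =
      (∑ n ∈ Finset.range K, ∑ m ∈ Finset.range K, y n * y m * M n m) -
        ∑ n ∈ Finset.range K, d n * y n ^ 2 := by
  simp only [mul_sub, Finset.sum_sub_distrib, mul_ite, mul_zero, Finset.sum_ite_eq]
  congr 1
  exact Finset.sum_congr rfl fun n hn ↦ by rw [if_pos hn]; ring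

/-- **Margin rung for Yoshida's matrix, shifted-kernel form** (`a > 0`). If the SHIFTED sector kernels
`M⁺ − μ·diag(w)` (`w₀ = 1`, `w_n = ½`) and `M⁻ − (μ/2)·1` of `G = gramCoeff a` are nonnegative real quadratic forms
on every `range K` — literally the conclusion of `sum_range_mul_mul_nonneg_of_certificate`
(`WeilFormatCSoundness.lean`) run on the shifted kernels — then `μ ≤ weilGroundEnergy a`. -/
theorem le_weilGroundEnergy_of_gramCoeff_shifted_sector_nonneg (ha : 0 < a) {μ : ℝ}
    (hev : ∀ (K : ℕ) (y : ℕ → ℝ), 0 ≤ ∑ n ∈ Finset.range K, ∑ m ∈ Finset.range K,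
      y n * y m * ((if n = 0 then gramCoeff a 0 m else if m = 0 then gramCoeff a n 0
            else (gramCoeff a n m + gramCoeff a n (-(m : ℤ))) / 2) -
          if n = m then μ * (if n = 0 then (1 : ℝ) else 1 / 2) else 0))
    (hod : ∀ (K : ℕ) (z : ℕ → ℝ), 0 ≤ ∑ k ∈ Finset.range K, ∑ l ∈ Finset.range K,
      z k * z l * ((gramCoeff a ((k : ℤ) + 1) ((l : ℤ) + 1) -
            gramCoeff a ((k : ℤ) + 1) (-((l : ℤ) + 1))) / 2 - if k = l then μ / 2 else 0)) :
    μ ≤ weilGroundEnergy a := by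
  refine le_weilGroundEnergy_of_gramCoeff_sector_margin ha (fun K y ↦ ?_) (fun K z ↦ ?_)
  · have h := hev K y
    rw [sum_range_mul_mul_sub_diag] at h
    have e : μ * ∑ n ∈ Finset.range K, (if n = 0 then (1 : ℝ) else 1 / 2) * y n ^ 2 =
        ∑ n ∈ Finset.range K, μ * (if n = 0 then (1 : ℝ) else 1 / 2) * y n ^ 2 := by
      rw [Finset.mul_sum]
      exact Finset.sum_congr rfl fun n _ ↦ by ring
    rw [e]
    linarith
  · have h := hod K z
    rw [sum_range_mul_mul_sub_diag K z _ (fun _ ↦ μ / 2)] at h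
    have e : μ * ∑ k ∈ Finset.range K, z k ^ 2 / 2 = ∑ k ∈ Finset.range K, μ / 2 * z k ^ 2 := by
      rw [Finset.mul_sum]
      exact Finset.sum_congr rfl fun k _ ↦ by ring
    rw [e]
    linarith

/-- **Strict rung, shifted-kernel form**: the same hypotheses with `0 < μ` give `0 < weilGroundEnergy a`. -/
theorem weilGroundEnergy_pos_of_gramCoeff_shifted_sector_nonneg (ha : 0 < a) {μ : ℝ} (hμ : 0 < μ)
    (hev : ∀ (K : ℕ) (y : ℕ → ℝ), 0 ≤ ∑ n ∈ Finset.range K, ∑ m ∈ Finset.range K,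
      y n * y m * ((if n = 0 then gramCoeff a 0 m else if m = 0 then gramCoeff a n 0
            else (gramCoeff a n m + gramCoeff a n (-(m : ℤ))) / 2) -
          if n = m then μ * (if n = 0 then (1 : ℝ) else 1 / 2) else 0))
    (hod : ∀ (K : ℕ) (z : ℕ → ℝ), 0 ≤ ∑ k ∈ Finset.range K, ∑ l ∈ Finset.range K,
      z k * z l * ((gramCoeff a ((k : ℤ) + 1) ((l : ℤ) + 1) -
            gramCoeff a ((k : ℤ) + 1) (-((l : ℤ) + 1))) / 2 - if k = l then μ / 2 else 0)) :
    0 < weilGroundEnergy a :=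
  hμ.trans_le (le_weilGroundEnergy_of_gramCoeff_shifted_sector_nonneg ha hev hod)

end Summit.RiemannHypothesis.RiemannHypothesis.Theorems.WeilFormatC

end
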